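import Summits.QuantumFields.BalabanUV.T4Continuum.Support.NE7GaugeStepResidue
import Summits.QuantumFields.BalabanUV.T4Continuum.Support.NE3QuadRemainderGaugeStep
import Summits.QuantumFields.BalabanUV.T4Continuum.Support.NE3ResidualSliceRep
import Summits.QuantumFields.BalabanUV.T4Continuum.Support.NE3CovariantBlockMean
import Summits.QuantumFields.BalabanUV.T4Continuum.Support.NE7CornerSpikeTopDictionary
import HarnessLib

/-!
# NE7SliceStepIdentities — THE EXACT ONE-STEP IDENTITIES OF THE (S1) ITERATION `u ↦ e^{−ζ(u)}·u` (memo ROAD-G100 §2.6): the next representative `X¹ = X⁰ − gaugeDir W ζ + J` with the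
# bond letter on `J`, the corner log `h¹ = h⁰ − ζ_c + j_c` with the BCH letter on `j_c`, the coarse datum `φ⁰ − φ¹ = −dirIter J + gaugeDir_V j_c`, the tangent part `T¹ = Ỹ⁰ + (J + N⁰ − N¹)`,
# and THE DATUM OF THE NEXT SPLIT IS THE CORNER JUNK ALONE: `h¹ − framePotW Ỹ⁰ = j_c`

Cell `pub-balaban`, rung (B)+1 sub-cell t4, lineage `b2b-balaban-t4-ne7-p1`, generation 100 (CRUX PROVER NE7 #1 = OWNER of BINDER row NE7).  Memo `t4/b2b-balaban-t4-ne7-p1-g100/ROAD-G100.md`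
§2.1–§2.2, §2.6.  STATE: a unitary periodic site gauge `u` with `U′^{u} = W·e^{X⁰}` (`gaugeAct u U′ = vary W X⁰ 1`), corner logs `u(M•z) = e^{h⁰ z}`; coarse datum `φ⁰ := dirIter X⁰ − gaugeDir_V h⁰`,
normal part `N⁰ := rightInvW φ⁰`, tangent part `T⁰ := X⁰ − N⁰`, split `T⁰ = Ỹ⁰ + gaugeDir W ζ` (`Ỹ⁰ ∈ 𝒯_E(W)`, nested mean of `ζ` EXACTLY `−(framePotW T⁰ − h⁰)`, `NE7SliceGaugeFunctionSized`).
STEP: `u¹ := e^{−ζ}·u`.  THIS FILE proves the identities of §2.6 BY NAME over gen 95's bond letter `NE7GaugeStepResidue.norm_gaugeStep_residue_le`, the BCH letter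
`NE3QuadRemainderGaugeStep.norm_mlog_exp_mul_exp_sub_le`, `NE3TangentCovariantTower.dirIter_gaugeDir` and `NE3CovariantBlockMean.framePotW_gaugeDir`; no estimate beyond those is made here.
WHAT ([folklore]; 0 def, 0 sorry).
§1 `gaugeDir_neg_fun`; **`step_rep`** (`gaugeAct (e^{−ζ}·u) U′ = vary W X¹ 1`, `X¹(b) := mlog(W(b)⁻¹(U′^{e^{−ζ}u})(b))`, for `‖ζ‖, ‖X⁰‖ ≤ 10⁻⁴`); **`step_residue_le`** (`‖X¹ − (X⁰ − gaugeDir W ζ)‖(b) ≤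
   16384‖gaugeDir W ζ(b)‖‖X⁰(b)‖ + 2048‖ζ(y+e_κ)‖‖gaugeDir W ζ(b)‖ + 6‖ζ(y+e_κ)‖‖X⁰(b)‖`); **`corner_residue_le`** (`h¹ z := mlog(e^{−ζ(M•z)}u(M•z))`: `‖h¹ z − (h⁰ z − ζ(M•z))‖ ≤ 4096‖ζ(M•z)‖‖h⁰ z‖`
   for `‖ζ(M•z)‖, ‖h⁰ z‖ ≤ 10⁻²`), `exp_corner_succ` (`e^{h¹ z} = e^{−ζ(M•z)}u(M•z)`).
§2 (multi-level small-field class) **`phi_sub_phi_succ`** (`φ⁰ − φ¹ = −dirIter J + gaugeDir_V j_c`), `tangent_succ` (`T¹ = Ỹ⁰ + (J + N⁰ − N¹)`), **`datum_succ`** (`h¹ − framePotW Ỹ⁰ = j_c`).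
HONEST FRAMING (page 1): exact kinematics∕BCH-by-name at ONE background; nothing of Bałaban's asserted; NOT the sizes (F3), NOT (L), NOT (S1), NOT NE7; spine 0∕9; finite T⁴ rung (B)+1 — NOT infinite
volume, NOT mass gap, NOT BetaPertH, NOT Clay.  Continuum YM on T⁴ ⇐ BetaPertH ∧ nine spine estimates (0/9 proved); BetaPertH ⇐ (D1) ∧ (D4) ∧ CAP+tail; G-an2-4 gates asym, D1 and NE2/3/4.
-/

set_option autoImplicit false

open scoped BigOperators Matrix.Norms.L2Operator
open NormedSpace Finset

namespace Summit.QuantumFields.BalabanUV.T4Continuum.NE7SliceStepIdentities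

open Literature.MathematicalPhysics.QuantumFieldTheory.Balaban1983to89
open B7Prop1Explicit B7Prop2Explicit MatrixLog
open T4AveragingDeficitWall (IsUnitaryCfg IsSkewDir SmallField vary Ad)
open T4AveragingDeficitWallBoundary (IsPeriodicCfg)
open AveragingDeficitMultiLevelPrep (cavgIter LevelSmall tower)
open BlockAveragePushDirGauge (gaugeDir)
open NE3EnergyShapes (IsUnitarySite)
open NE3TangentCovariantTower (dirIter framePotW dirIter_add dirIter_gaugeDir)
open NE3TangentCovariantStructure (gaugeDir_add_fun)
open NE3ResidualSliceRep (dirIter_sub framePotW_sub)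
open NE3CovariantBlockMean (bmeanIterW framePotW_gaugeDir)
open NE3QuadRemainderGaugeStep (norm_mlog_exp_mul_exp_sub_le)
open NE7GaugeStepResidue (norm_gaugeStep_residue_le gaugeAct_expUnit_vary_eq_vary_mlog inv_mul_gaugeAct_expUnit_vary)
open NE7CornerSpikeTopDictionary (gaugeDir_sub_fun gaugeDir_smul_fun)
open BlockAverageLogInteraction (norm_exp_sub_one_le_two_mul)

noncomputable section

variable {d : ℕ} {n : Type*} [Fintype n] [DecidableEq n]

/-! ## §1 The step in the chart, the bond residue, the corner residue -/

/-- `gaugeDir W (−λ) = −gaugeDir W λ`. [folklore] -/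
theorem gaugeDir_neg_fun (W : Site d → Fin d → (Matrix n n ℂ)ˣ) (lam : Site d → Matrix n n ℂ) (z : Site d) (κ : Fin d) :
    gaugeDir W (fun x => -lam x) z κ = -gaugeDir W lam z κ := by
  have e : (fun x => -lam x) = fun x => (-1 : ℝ) • lam x := funext fun x => by rw [neg_one_smul]
  rw [e, gaugeDir_smul_fun, neg_one_smul]

/-- **THE STEP IN THE CHART**: if `U′^{u} = W·e^{X⁰}` (`W` unitary, `‖ζ‖, ‖X⁰‖ ≤ 10⁻⁴` everywhere) then `U′^{e^{−ζ}u} = W·e^{X¹}` with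
`X¹(b) := mlog(W(b)⁻¹·U′^{e^{−ζ}u}(b))`. [folklore] -/
theorem step_rep [Nonempty n] {W U' : Site d → Fin d → (Matrix n n ℂ)ˣ} (hW : IsUnitaryCfg W) {u : Site d → (Matrix n n ℂ)ˣ} {X : Site d → Fin d → Matrix n n ℂ}
    (hgauge : gaugeAct u U' = vary W X 1) {ζ : Site d → Matrix n n ℂ} (hζ : ∀ y, ‖ζ y‖ ≤ 1 / 10000) (hX : ∀ y κ, ‖X y κ‖ ≤ 1 / 10000) :
    gaugeAct ((fun y => expUnit (-ζ y)) * u) U'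
      = vary W (fun y κ => mlog ((((W y κ)⁻¹ : (Matrix n n ℂ)ˣ) : Matrix n n ℂ) * ((gaugeAct ((fun y => expUnit (-ζ y)) * u) U' y κ : (Matrix n n ℂ)ˣ) : Matrix n n ℂ))) 1 := by
  have hmul : gaugeAct ((fun y => expUnit (-ζ y)) * u) U' = gaugeAct (fun y => expUnit (-ζ y)) (gaugeAct u U') := by
    funext x μ; simp only [gaugeAct, Pi.mul_apply, mul_inv_rev, mul_assoc]
  rw [hmul, hgauge]
  exact gaugeAct_expUnit_vary_eq_vary_mlog hW (μ := fun y => -ζ y) (fun y => by rw [norm_neg]; exact hζ y) hX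

/-- **THE BOND RESIDUE OF THE STEP** (`W` unitary, `‖ζ‖ ≤ 10⁻⁴` at the two ends of the bond, `‖X⁰(b)‖ ≤ 10⁻⁴`): with `X¹(b) := mlog(W(b)⁻¹·U′^{e^{−ζ}u}(b))`,
`‖X¹(b) − (X⁰(b) − gaugeDir W ζ(b))‖ ≤ 16384‖gaugeDir W ζ(b)‖‖X⁰(b)‖ + 2048‖ζ(y+e_κ)‖‖gaugeDir W ζ(b)‖ + 6‖ζ(y+e_κ)‖‖X⁰(b)‖`. [folklore] -/
theorem step_residue_le [Nonempty n] {W U' : Site d → Fin d → (Matrix n n ℂ)ˣ} (hW : IsUnitaryCfg W) {u : Site d → (Matrix n n ℂ)ˣ} {X : Site d → Fin d → Matrix n n ℂ}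
    (hgauge : gaugeAct u U' = vary W X 1) {ζ : Site d → Matrix n n ℂ} (y : Site d) (κ : Fin d)
    (hζy : ‖ζ y‖ ≤ 1 / 10000) (hζy' : ‖ζ (y + e κ)‖ ≤ 1 / 10000) (hX : ‖X y κ‖ ≤ 1 / 10000) :
    ‖mlog ((((W y κ)⁻¹ : (Matrix n n ℂ)ˣ) : Matrix n n ℂ) * ((gaugeAct ((fun y => expUnit (-ζ y)) * u) U' y κ : (Matrix n n ℂ)ˣ) : Matrix n n ℂ))
        - (X y κ - gaugeDir W ζ y κ)‖
      ≤ 16384 * ‖gaugeDir W ζ y κ‖ * ‖X y κ‖ + 2048 * ‖ζ (y + e κ)‖ * ‖gaugeDir W ζ y κ‖ + 6 * ‖ζ (y + e κ)‖ * ‖X y κ‖ := by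
  have hmul : gaugeAct ((fun y => expUnit (-ζ y)) * u) U' = gaugeAct (fun y => expUnit (-ζ y)) (gaugeAct u U') := by
    funext x μ; simp only [gaugeAct, Pi.mul_apply, mul_inv_rev, mul_assoc]
  rw [hmul, hgauge]
  have h := norm_gaugeStep_residue_le hW (μ := fun y => -ζ y) (X := X) y κ (by rw [norm_neg]; exact hζy) (by rw [norm_neg]; exact hζy') hX
  rw [gaugeDir_neg_fun, norm_neg, norm_neg, ← sub_eq_add_neg] at h
  exact h

/-- **THE CORNER RESIDUE OF THE STEP**: if `u(c) = e^{h⁰}` (as matrices) with `‖ζ(c)‖, ‖h⁰‖ ≤ 10⁻²`, then `h¹ := mlog(e^{−ζ(c)}·u(c))` satisfies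
`‖h¹ − (h⁰ − ζ(c))‖ ≤ 4096‖ζ(c)‖‖h⁰‖`. [folklore] -/
theorem corner_residue_le [Nonempty n] {uc : (Matrix n n ℂ)ˣ} {h0 ζc : Matrix n n ℂ} (hcorner : ((uc : (Matrix n n ℂ)ˣ) : Matrix n n ℂ) = exp h0)
    (hζ : ‖ζc‖ ≤ 1 / 100) (hh : ‖h0‖ ≤ 1 / 100) :
    ‖mlog (((expUnit (-ζc) * uc : (Matrix n n ℂ)ˣ) : Matrix n n ℂ)) - (h0 - ζc)‖ ≤ 4096 * ‖ζc‖ * ‖h0‖ := by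
  rw [Units.val_mul, val_expUnit, hcorner]
  have h := norm_mlog_exp_mul_exp_sub_le (A := -ζc) (B := h0) (by rw [norm_neg]; exact hζ) hh
  rw [norm_neg] at h
  have e : -ζc + h0 = h0 - ζc := by abel
  rwa [e] at h

/-- the corner invariant propagates: `e^{h¹} = e^{−ζ(c)}·u(c)` (the product is in the ball of `mlog`). [folklore] -/
theorem exp_corner_succ [Nonempty n] {uc : (Matrix n n ℂ)ˣ} {h0 ζc : Matrix n n ℂ} (hcorner : ((uc : (Matrix n n ℂ)ˣ) : Matrix n n ℂ) = exp h0)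
    (hζ : ‖ζc‖ ≤ 1 / 100) (hh : ‖h0‖ ≤ 1 / 100) :
    exp (mlog (((expUnit (-ζc) * uc : (Matrix n n ℂ)ˣ) : Matrix n n ℂ))) = ((expUnit (-ζc) * uc : (Matrix n n ℂ)ˣ) : Matrix n n ℂ) := by
  apply exp_mlog
  rw [Units.val_mul, val_expUnit, hcorner]
  have h1 := (norm_exp_sub_one_le_two_mul (Y := -ζc) (r := 1 / 100) (by rw [norm_neg]; exact hζ) (by norm_num)).1
  have h2 := (norm_exp_sub_one_le_two_mul hh (by norm_num : (1 : ℝ) / 100 ≤ 1)).1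
  have h := B7Prop6Bound.mul_sub_one_norm_le (exp (-ζc)) (exp h0)
  have h' : (1 + ‖exp (-ζc) - 1‖) * (1 + ‖exp h0 - 1‖) - 1 ≤ (1 + 2 * (1 / 100)) * (1 + 2 * (1 / 100)) - 1 := by
    have a0 := norm_nonneg (exp (-ζc) - 1)
    have b0 := norm_nonneg (exp h0 - 1)
    nlinarith
  exact lt_of_le_of_lt (h.trans h') (by norm_num)

/-! ## §2 The coarse datum, the tangent part and the datum of the next split -/

/-- **THE COARSE DATUM MOVES BY THE JUNK ALONE** (multi-level small-field class at level `k+1`, `W` unitary `(tower L N (k+1))`-periodic, `ζ` skew periodic, `M = L^{k+1}`,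
`V = cavgIter L (k+1) W`): if `X¹ = X⁰ − gaugeDir W ζ + J` and `h¹ z = h⁰ z − ζ(M•z) + j_c z`, then
`(dirIter X⁰ − gaugeDir_V h⁰) − (dirIter X¹ − gaugeDir_V h¹) = −dirIter J + gaugeDir_V j_c` (`dirIter(gaugeDir W ζ) = gaugeDir_V ζ(M•·)`). [folklore] -/
theorem phi_sub_phi_succ [Nonempty n] {L N : ℕ} [NeZero N] (hL : 1 ≤ L) (k : ℕ) {W : Site d → Fin d → (Matrix n n ℂ)ˣ} {x : ℝ}
    (hWu : IsUnitaryCfg W) (hWP : IsPeriodicCfg W ((tower L N (k + 1) : ℕ) : ℤ)) (hx : 0 ≤ x) (hs : LevelSmall d L k x) (hWx : SmallField W x)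
    {X0 X1 J : Site d → Fin d → Matrix n n ℂ} {ζ h0 h1 jc : Site d → Matrix n n ℂ}
    (hζs : ∀ y, ζ y ∈ skewAdjoint (Matrix n n ℂ)) (hζP : ∀ (y : Site d) (i : Fin d), ζ (y + ((tower L N (k + 1) : ℕ) : ℤ) • e i) = ζ y)
    (hX1 : ∀ y κ, X1 y κ = X0 y κ - gaugeDir W ζ y κ + J y κ) (hh1 : ∀ z, h1 z = h0 z - ζ (((L : ℤ) ^ (k + 1)) • z) + jc z) (z : Site d) (κ : Fin d) :
    (dirIter L (k + 1) W X0 z κ - gaugeDir (cavgIter L (k + 1) W) h0 z κ) - (dirIter L (k + 1) W X1 z κ - gaugeDir (cavgIter L (k + 1) W) h1 z κ)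
      = -dirIter L (k + 1) W J z κ + gaugeDir (cavgIter L (k + 1) W) jc z κ := by
  -- `dirIter X¹ = dirIter X⁰ − gaugeDir_V ζ_c + dirIter J`
  have eX1 : X1 = fun y κ => (fun y κ => X0 y κ - gaugeDir W ζ y κ) y κ + J y κ := funext fun y => funext fun κ => hX1 y κ
  have hdir : dirIter L (k + 1) W X1 z κ = dirIter L (k + 1) W X0 z κ - gaugeDir (cavgIter L (k + 1) W) (fun y => ζ (((L : ℤ) ^ (k + 1)) • y)) z κ
      + dirIter L (k + 1) W J z κ := by
    rw [eX1, dirIter_add hL k hWu hx hs hWx, dirIter_sub hL k hWu hx hs hWx, dirIter_gaugeDir hL k hWu hWP hx hs hWx hζs hζP]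
  -- `gaugeDir_V h¹ = gaugeDir_V h⁰ − gaugeDir_V ζ_c + gaugeDir_V j_c`
  have eh1 : h1 = fun z => (fun z => h0 z - ζ (((L : ℤ) ^ (k + 1)) • z)) z + jc z := funext hh1
  have hg : gaugeDir (cavgIter L (k + 1) W) h1 z κ = gaugeDir (cavgIter L (k + 1) W) h0 z κ - gaugeDir (cavgIter L (k + 1) W) (fun y => ζ (((L : ℤ) ^ (k + 1)) • y)) z κ
      + gaugeDir (cavgIter L (k + 1) W) jc z κ := by
    rw [eh1, gaugeDir_add_fun, ← gaugeDir_sub_fun]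
  rw [hdir, hg]
  abel

/-- **THE TANGENT PART AFTER THE STEP**: `T⁰ = X⁰ − N⁰ = Ỹ⁰ + gaugeDir W ζ` and `X¹ = X⁰ − gaugeDir W ζ + J` give `T¹ := X¹ − N¹ = Ỹ⁰ + (J + N⁰ − N¹)`. [folklore] -/
theorem tangent_succ {W : Site d → Fin d → (Matrix n n ℂ)ˣ} {X0 X1 J N0 N1 Yt : Site d → Fin d → Matrix n n ℂ} {ζ : Site d → Matrix n n ℂ}
    (hsplit : ∀ y κ, X0 y κ - N0 y κ = Yt y κ + gaugeDir W ζ y κ) (hX1 : ∀ y κ, X1 y κ = X0 y κ - gaugeDir W ζ y κ + J y κ) (y : Site d) (κ : Fin d) :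
    X1 y κ - N1 y κ = Yt y κ + (J y κ + N0 y κ - N1 y κ) := by
  have h := hsplit y κ
  rw [hX1 y κ]
  have e : X0 y κ = Yt y κ + gaugeDir W ζ y κ + N0 y κ := by rw [← h]; abel
  rw [e]; abel

/-- **THE DATUM OF THE NEXT SPLIT IS THE CORNER JUNK** (class at level `k+1`, `W` unitary `(tower)`-periodic, `ζ` skew periodic, `M = L^{k+1}`): if `T⁰ = Ỹ⁰ + gaugeDir W ζ`,
`bmeanIterW ζ = −(framePotW T⁰ − h⁰)` (the normalisation of `NE7SliceGaugeFunctionSized`) and `h¹ z = h⁰ z − ζ(M•z) + j_c z`, then `h¹ z − framePotW Ỹ⁰ z = j_c z`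
(`framePotW(gaugeDir W ζ) = ζ(M•·) − bmeanIterW ζ`). [folklore] -/
theorem datum_succ [Nonempty n] {L N : ℕ} [NeZero N] (hL : 1 ≤ L) (k : ℕ) {W : Site d → Fin d → (Matrix n n ℂ)ˣ} {x : ℝ}
    (hWu : IsUnitaryCfg W) (hWP : IsPeriodicCfg W ((tower L N (k + 1) : ℕ) : ℤ)) (hx : 0 ≤ x) (hs : LevelSmall d L k x) (hWx : SmallField W x)
    {T0 Yt : Site d → Fin d → Matrix n n ℂ} {ζ h0 h1 jc : Site d → Matrix n n ℂ}
    (hζs : ∀ y, ζ y ∈ skewAdjoint (Matrix n n ℂ)) (hζP : ∀ (y : Site d) (i : Fin d), ζ (y + ((tower L N (k + 1) : ℕ) : ℤ) • e i) = ζ y)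
    (hsplit : ∀ y κ, T0 y κ = Yt y κ + gaugeDir W ζ y κ) (hmean : ∀ z, bmeanIterW L (k + 1) W ζ z = -(framePotW L (k + 1) W T0 z - h0 z))
    (hh1 : ∀ z, h1 z = h0 z - ζ (((L : ℤ) ^ (k + 1)) • z) + jc z) (z : Site d) :
    h1 z - framePotW L (k + 1) W Yt z = jc z := by
  have eYt : Yt = fun y κ => T0 y κ - gaugeDir W ζ y κ := funext fun y => funext fun κ => by rw [hsplit y κ]; abel
  rw [eYt, framePotW_sub hL k hWu hx hs hWx, framePotW_gaugeDir hL k hWu hWP hx hs hWx hζs hζP, hmean z, hh1 z]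
  abel

end

end Summit.QuantumFields.BalabanUV.T4Continuum.NE7SliceStepIdentities
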